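import Summits.CriticalPhenomena.PercolationContinuityZ3.Theorems.Transplant.SkelFrmFrom1RootHoldsQ3VNode
import HarnessLib

/-!
# U_s execution (RULING D-Us / Us-R6, lead g22 2026-08-26; «TUPLE Px OF RECORD», design owner p3 g27, bus 22:51Z): «SkelFrmFromBChoiceSlotsPx» —
# THE NODE TUPLE UNDER PROXIES at radius `D`: the U node tuple of «SkelFrmFrom1HoldsAll» READ AT THE RAISED KIT INDEX `m′(t, Drec) := KS.RK t Drec 0 + D`
# inside each slot's own lambda (K-2 for every column, TUPLE COHERENCE RULE-Px), plus the two `+ D` window floors of the excess slot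

builds on p205010 (kernel theorem, internal audit signed; external expert review pending) — nothing in this file uses p205010; NOTHING is claimed about the
OPEN node U_s `SamePDropOfSkeletonFrmScaled₁`.  Lane `prim-bschramm`; text by the design owner `prim-bschramm-p3` gen 27 for the DEF-row pen (gen-1 g0, RULING
Us-R2/Us-R6) — helper file (`--supports stmt-CriticalPhenomena-4575 --as helper`); DEF row (slot VALUES only: every definition is a lower-bound floor device or the
U constructor re-indexed; no statement, no `@[conjecture]` edit).
§1 the index-raising wrappers `raiseF/raiseG/raiseP/raiseC` (one per slot type: evaluate an index-parametrised U slot at `KS.RK t Drec mk + D`) with rfl `_at`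
lemmas; §2 the `+ D` excess residual `exRD m D := exR0 m ⊔ (r₀0 m (RLD + D) + 3) ⊔ (r₀0 m (RB0 m + D) + 1)` and its floors; §3 the tuple at radius `D`:
`gvPx D := raiseF (fun m => KS.gT m (gxQ m (gxR0 m) (fxR m))) 0 D`, `fvPx D := raiseF (fun m => KS.fT m (fxQ m (fxR m))) 0 D`, `PvPx D := raiseP (fun m =>
KS.PR m (PxQ m (PxR m))) 0 D`, `exPx D := raiseG (fun m => exQ m (exRD m D)) 0 D`, `mxPx D := raiseG (fun m => mxQ (mxF m)) 0 D`, `cvPx D := raiseC cR2W 0 D`,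
`hvPx D := raiseC hFR 0 D` (the fibre slot is `SUS (exPx D) (mxPx D)`, the arrival box stays `BSlot.small3`); §4 the values unfolded at a record (rfl lemmas the
column tops rewrite with).  WHY THIS IS THE WHOLE TUPLE: with ONE raised-index function for all columns, every U floor lemma (gxC_floors, le_gT_gxQ, two_fT_le_gT,
le_fT_fxQ, le_exQ, exR0_floors, subset_PR_PxQ, RA'_le_r_TA, T₀a_lt_RA', rowX1_Q/…, bOf_small3_eq, cR2W/hFR by rfl) serves at `m′` verbatim; the only Px additions
are lower-bound floors (`exRD`'s two `+ D` rows) — p5's test 'a slot that is not a lower-bound floor is a located item' has nothing else to read.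
[cite: KozmaNitzan2024, §4 Theorem 6 (pp. 25–31), p. 28 ((32))] [cite: BenjaminiSchramm1996, Conj. 4] [this work]
-/

noncomputable section

open scoped Classical

namespace Summit.CriticalPhenomena.PercolationContinuityZ3.Theorems.Transplant

open MeasureTheory Literature.Probability.Percolation Literature.Probability.LatticeModels SimpleGraph KNCells KNLevels
open SkelConc (Consts)
open Skelφ.StepI (DataN DataNS OutNS)

namespace PlanarSkeletonFrmFrom

namespace NegB

open Neg

/-! ## §1 The index-raising wrappers (K-2: evaluate an index-parametrised slot at `KS.RK t Drec mk + D`) -/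

/-- **Raise the kit index of a box/width slot family**: `raiseF X mk D` reads `X (KS.RK t Drec mk + D)` at every record `Drec`. [this work] -/
def raiseF (X : ℕ → Neg.FSlot) (mk D : ℕ) : Neg.FSlot := fun κ _ _ _ _ _ Φ t p Drec => X (KS.RK t Drec mk + D) κ Φ t p Drec

/-- **Raise the kit index of an excess/diameter slot family**. [this work] -/
def raiseG (X : ℕ → GSlot) (mk D : ℕ) : GSlot := fun κ _ _ _ _ _ Φ t p Drec g f => X (KS.RK t Drec mk + D) κ Φ t p Drec g f

/-- **Raise the kit index of an extra-pairs slot family**. [this work] -/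
def raiseP (X : ℕ → PSlot) (mk D : ℕ) : PSlot := fun κ _ _ _ _ _ Φ t p Drec => X (KS.RK t Drec mk + D) κ Φ t p Drec

/-- **Raise the kit index of a creep/room slot family**. [this work] -/
def raiseC (X : ℕ → CSlot) (mk D : ℕ) : CSlot := fun κ _ _ _ _ _ Φ t p Drec g f i => X (KS.RK t Drec mk + D) κ Φ t p Drec g f i

section At

variable (κ : Consts) {V : Type} [DecidableEq V] [Countable V] {G : SimpleGraph V} [G.LocallyFinite] (Φ : PlanarSkeletonFrmFrom G) (t : V) (p : unitInterval)
  (Drec : DataNS V)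

/-- `raiseF X mk D` at a record is `X` at the raised index (by `rfl`). [folklore] -/
@[simp] theorem raiseF_at (X : ℕ → Neg.FSlot) (mk D : ℕ) : raiseF X mk D κ Φ t p Drec = X (KS.RK t Drec mk + D) κ Φ t p Drec := rfl

/-- `raiseG X mk D` at a record is `X` at the raised index (by `rfl`). [folklore] -/
@[simp] theorem raiseG_at (X : ℕ → GSlot) (mk D : ℕ) (g f : ℕ) : raiseG X mk D κ Φ t p Drec g f = X (KS.RK t Drec mk + D) κ Φ t p Drec g f := rfl

/-- `raiseP X mk D` at a record is `X` at the raised index (by `rfl`). [folklore] -/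
@[simp] theorem raiseP_at (X : ℕ → PSlot) (mk D : ℕ) : raiseP X mk D κ Φ t p Drec = X (KS.RK t Drec mk + D) κ Φ t p Drec := rfl

/-- `raiseC X mk D` at a record is `X` at the raised index (by `rfl`). [folklore] -/
@[simp] theorem raiseC_at (X : ℕ → CSlot) (mk D : ℕ) (g f : ℕ) (i : Fin 2) : raiseC X mk D κ Φ t p Drec g f i = X (KS.RK t Drec mk + D) κ Φ t p Drec g f i := rfl

end At

/-! ## §2 The `+ D` excess residual -/

/-- **The (R)/(C) excess residual with the two proxied window floors**: `exRD m D := exR0 m ⊔ (r₀0 m (RLD + D) + 3) ⊔ (r₀0 m (RB0 m + D) + 1)` — the U residual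
«SkelFrmFromBChoiceResidR».exR0 at index `m` together with the long-link window floor at radius `RL + D` (`+ 3`: the (C) ledger's form, ≥ the (R)'s `+ 1`) and the
bridge window floor at radius `RB0 + D`. Lower bounds only. [this work] -/
def exRD (m D : ℕ) : GSlot := fun κ _ _ _ _ _ Φ t p Drec g f =>
  max (exR0 m κ Φ t p Drec g f) (max (KS0.r₀0 t Drec m (RLD κ Φ t p Drec g f + D) + 3) (KS0.r₀0 t Drec m (KS.RB0 κ Φ t p Drec m + D) + 1))

/-- `exRD` dominates the U residual `exR0` and the two `+ D` window floors. [folklore] -/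
theorem exRD_floors (κ : Consts) {V : Type} [DecidableEq V] [Countable V] {G : SimpleGraph V} [G.LocallyFinite] (Φ : PlanarSkeletonFrmFrom G) (t : V)
    (p : unitInterval) (Drec : DataNS V) (m D g f : ℕ) {ex : ℕ} (h : exRD m D κ Φ t p Drec g f ≤ ex) :
    exR0 m κ Φ t p Drec g f ≤ ex ∧ KS0.r₀0 t Drec m (RLD κ Φ t p Drec g f + D) + 3 ≤ ex ∧ KS0.r₀0 t Drec m (KS.RB0 κ Φ t p Drec m + D) + 1 ≤ ex := by
  unfold exRD at h
  simp only [max_le_iff] at h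
  exact ⟨h.1, h.2.1, h.2.2⟩

/-! ## §3 The tuple at radius `D` -/

/-- **The box slot of record under proxies**: `gT m′ (gxQ m′ (gxR0 m′) (fxR m′))` at the raised index. [this work] -/
def gvPx (D : ℕ) : Neg.FSlot := raiseF (fun m => KS.gT m (gxQ m (gxR0 m) (fxR m))) 0 D

/-- **The width slot of record under proxies**: `fT m′ (fxQ m′ (fxR m′))` at the raised index. [this work] -/
def fvPx (D : ℕ) : Neg.FSlot := raiseF (fun m => KS.fT m (fxQ m (fxR m))) 0 D

/-- **The extra-pairs slot of record under proxies**: `PR m′ (PxQ m′ (PxR m′))` at the raised index (kit pair, bridge pair, face pairs at `m′`). [this work] -/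
def PvPx (D : ℕ) : PSlot := raiseP (fun m => KS.PR m (PxQ m (PxR m))) 0 D

/-- **The excess slot of record under proxies**: `exQ m′ (exRD m′ D)` at the raised index. [this work] -/
def exPx (D : ℕ) : GSlot := raiseG (fun m => exQ m (exRD m D)) 0 D

/-- **The rim-diameter slot of record under proxies**: `mxQ (mxF m′)` at the raised index. [this work] -/
def mxPx (D : ℕ) : GSlot := raiseG (fun m => mxQ (mxF m)) 0 D

/-- **The creep slot of record under proxies**: `cR2W m′` at the raised index (gen-1's `cR2WPx 0 D`). [this work] -/
def cvPx (D : ℕ) : CSlot := raiseC cR2W 0 D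

/-- **The forward-room slot of record under proxies**: `hFR m′` at the raised index (gen-1's `hFRPx 0 D`). [this work] -/
def hvPx (D : ℕ) : CSlot := raiseC hFR 0 D

/-! ## §4 The values at a record (what the column tops rewrite with) -/

section Values

variable (κ : Consts) {V : Type} [DecidableEq V] [Countable V] {G : SimpleGraph V} [G.LocallyFinite] (Φ : PlanarSkeletonFrmFrom G) (t : V) (p : unitInterval)
  (Drec : DataNS V) (D : ℕ)

/-- The box slot at a record (by `rfl`). [folklore] -/
theorem gvPx_at : gvPx D κ Φ t p Drec = KS.gT (KS.RK t Drec 0 + D) (gxQ (KS.RK t Drec 0 + D) (gxR0 (KS.RK t Drec 0 + D)) (fxR (KS.RK t Drec 0 + D))) κ Φ t p Drec := rfl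

/-- The width slot at a record (by `rfl`). [folklore] -/
theorem fvPx_at : fvPx D κ Φ t p Drec = KS.fT (KS.RK t Drec 0 + D) (fxQ (KS.RK t Drec 0 + D) (fxR (KS.RK t Drec 0 + D))) κ Φ t p Drec := rfl

/-- The extra-pairs slot at a record (by `rfl`). [folklore] -/
theorem PvPx_at : PvPx D κ Φ t p Drec = KS.PR (KS.RK t Drec 0 + D) (PxQ (KS.RK t Drec 0 + D) (PxR (KS.RK t Drec 0 + D))) κ Φ t p Drec := rfl

/-- The excess slot at a record (by `rfl`). [folklore] -/
theorem exPx_at (g f : ℕ) : exPx D κ Φ t p Drec g f = exQ (KS.RK t Drec 0 + D) (exRD (KS.RK t Drec 0 + D) D) κ Φ t p Drec g f := rfl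

/-- The rim-diameter slot at a record (by `rfl`). [folklore] -/
theorem mxPx_at (g f : ℕ) : mxPx D κ Φ t p Drec g f = mxQ (mxF (KS.RK t Drec 0 + D)) κ Φ t p Drec g f := rfl

/-- The creep slot at a record (by `rfl`). [folklore] -/
theorem cvPx_at (g f : ℕ) (i : Fin 2) : cvPx D κ Φ t p Drec g f i = cR2W (KS.RK t Drec 0 + D) κ Φ t p Drec g f i := rfl

/-- The forward-room slot at a record (by `rfl`). [folklore] -/
theorem hvPx_at (g f : ℕ) (i : Fin 2) : hvPx D κ Φ t p Drec g f i = hFR (KS.RK t Drec 0 + D) κ Φ t p Drec g f i := rfl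

/-- The creep slot at a record is the U creep value at the raised index (gen-1's `Hc` by `rfl`). [folklore] -/
theorem cvPx_eq (g f : ℕ) (i : Fin 2) : cvPx D κ Φ t p Drec g f i = cR2vW κ Φ t p Drec g f (KS.RK t Drec 0 + D) i := rfl

/-- The forward-room slot at a record is the U room value at the raised index (gen-1's `Hh` by `rfl`). [folklore] -/
theorem hvPx_eq (g f : ℕ) (i : Fin 2) : hvPx D κ Φ t p Drec g f i = hFRv κ Φ t p Drec g f (KS.RK t Drec 0 + D) i := rfl

end Values

end NegB

end PlanarSkeletonFrmFrom

end Summit.CriticalPhenomena.PercolationContinuityZ3.Theorems.Transplant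

end
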